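/-
Copyright (c) 2026 the pub-hodgecm-mathlib formalisation cell (harness21).  Prover seat hodgecm-mathlib-K2Liu-p12 (g2): Track B «K2-LIT»,
#184♮ = hLiu418 = stmt-HodgeConjecture-24832; Road Φ of socket #41, organ Φ4-EXACT (LEAD F0P6-plan ruling «M-157p»), file E6-inert.
-/
import Summits.HodgeConjecture.HodgeConjecture.Theorems.K2LiuGoodPlaceWhittakerUnimodularValue   -- ★ E5: the assembly engine
import Summits.HodgeConjecture.HodgeConjecture.Theorems.K2LiuSkewResidueQuadricInert           -- ★ E3c: `I(1,1) = +q_v μ(B0)` at an inert unramified place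
import HarnessLib

/-!
# Crux `HLiu418`, Road Φ of socket #41, organ Φ4-EXACT — FILE E6 (inert): THE UNIMODULAR UNRAMIFIED WHITTAKER VALUE AT AN INERT PLACE

Cell `hodgecm-mathlib`, crux item hLiu418 = `stmt-HodgeConjecture-24832`, route of record `HCCMUnconditional`; squad K2 ∕ K2Liu, road `K2_Liu`,
socket #41 `sig_K2LiuSiegelEisensteinContinuation`, Road Φ, organ Φ4-EXACT (ruling M-157p; method memo `K2/K2Liu-p12/g2/CENSUS-PHI4-EXACT-Method.K2Liu-p12-g2.md`).
THEOREMS ONLY (no `def`, no `instance`, no `notation`, no named-fact hypothesis, no `sorry`); lane `--supports stmt-HodgeConjecture-24832`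
(count-neutral helper; closes no socket by itself).

THE STATEMENT.  At a good place `v ∤ 2` of `F` INERT and UNRAMIFIED in `E` (`c • w₀ = w₀`, `|ι_w ϖ|_w = exp(−1)`, `δ̂` a unit at `w₀`), for the
spherical section `φ_s` of `I_v(s,χ_v)` (`χ_w` unramified), `ψ_v` of conductor `0`, and a `v`-unimodular `T`-skew Fourier index `β`:
  **`∫_{B(−3)} φ_s(w_Δ n t) ψ_v(−τ tr(βt)) dμ(t) = μ(B(0)) · (1 − t)(1 + q_v t)`**,  `t = (∏_{w∣v} χ_w(ι_w ϖ))·(∏_{w∣v} ‖ι_w ϖ‖_w)^{s+1}`, `q_v = v.residueCard`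
— ★ E5 `setIntegral_whittaker_unimodular_eq` fed with ★ E3c `setIntegral_ball_inter_det_eq_inert` (`C = +q_v = −η_v q_v`, `η_v = −1`).  In the CM
letters (`w₀` the unique place over `v`, `χ_{w₀}` unramified, `‖ι_{w₀} ϖ‖_{w₀} = q_v^{−2}`) this is the inert local factor `μ(B(0))·b_v(s)⁻¹` of ★ O41.6;
together with ★ E6-split (`C = −q_v`, `η_v = +1`) it is organ Φ4-EXACT at every good unramified place.

## References
* [Shimura1997] G. Shimura, *Euler Products and Eisenstein Series*, CBMS 93 (1997), Thm. 13.6, Prop. 14.9.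
* [KudlaSweet1997] S. Kudla, W. J. Sweet, Israel J. Math. 98 (1997), §1.   * [Liu2011] Y. Liu, Algebra Number Theory 5 (2011), §2A (2-2), (2-10).
-/

set_option autoImplicit false
-- the mandated namespace repeats the single-problem summit's segment (`HodgeConjecture.HodgeConjecture`)
set_option linter.dupNamespace false

noncomputable section

open scoped NNReal ENNReal Matrix Topology
open NumberField IsDedekindDomain Matrix MeasureTheory Set Filter
open Literature.NumberTheory.Automorphic Literature.NumberTheory.Automorphic.UnitaryGroup
open Literature.NumberTheory.GelbartRogawski1991.AdaptedBlocks
open Literature.NumberTheory.GelbartRogawski1991.UnitaryDualPair.LocalSplitting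
open Literature.NumberTheory.K2Lit.LocalSiegelDoubled
open Summit.HodgeConjecture.HodgeConjecture.Cruxes.HLiu418.K2LiuGoodPlaceWhittakerUnimodularValue
open Summit.HodgeConjecture.HodgeConjecture.Cruxes.HLiu418.K2LiuSkewResidueQuadricInert

namespace Summit.HodgeConjecture.HodgeConjecture.Cruxes.HLiu418.K2LiuGoodPlaceWhittakerUnimodularValueInert

variable (F : Type) [Field F] [NumberField F] (E : Type) [Field E] [NumberField E] [Algebra F E]
  [Algebra.IsQuadraticExtension F E] (c : E ≃ₐ[F] E) {δ : E} (hcδ : c δ = -δ) (hδ : δ ≠ 0) {dd : F} (hd : δ * δ = algebraMap F E dd)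
  (v : HeightOneSpectrum (𝓞 F)) {T₀ : Matrix (Fin 2) (Fin 2) F}
  (hT₀ : T₀.IsSymm) (hT₀d : IsUnit T₀.det)
  {JD : Matrix (Fin (2 + 2)) (Fin (2 + 2)) E} (hJD : JD = (gramD F 2 T₀).map (algebraMap F E))
  {π : v.adicCompletion F} (hπ : Valued.v π = WithZero.exp (-1 : ℤ)) (hπw : ∀ w : PlacesOver E v, Valued.v (toPlace v w π) = WithZero.exp (-1 : ℤ))
  (w₀ : PlacesOver E v) (hw₀ : c • w₀.1 = w₀.1)

include hcδ hδ hd hT₀ hT₀d hJD hπ hπw hw₀ in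
/-- **THE UNIMODULAR VALUE OF THE UNRAMIFIED WHITTAKER COEFFICIENT AT AN INERT UNRAMIFIED PLACE**: `∫_{B(−3)} φ_s(w_Δ n t)·ψ_v(−τ tr(βt)) dμ =
μ(B(0))·(1 − t)(1 + q_v t)`, `t = (∏_w χ_w(ι_w ϖ))·(∏_w ‖ι_w ϖ‖_w)^{s+1}` — ★ E5 engine + ★ E3c `I(1,1) = +q_v μ(B(0))` (`δ̂` a unit at `w₀`, `|2|_v = 1`).
[cite: Shimura1997, Thm. 13.6] [cite: KudlaSweet1997, §1] [cite: Liu2011, §2A (2-2)] -/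
theorem setIntegral_whittaker_unimodular_eq_inert
    (S : AddSubgroup (Matrix (Fin 2) (Fin 2) (LocalRing E v)))
    (hS : ∀ t, t ∈ S ↔ (t.map (conjLocal E c v))ᵀ * gramS F E v 2 T₀ + gramS F E v 2 T₀ * t = 0)
    [MeasurableSpace S] [BorelSpace S] (μ : Measure S) [μ.IsAddHaarMeasure]
    (h2v : ∀ w : PlacesOver E v, ValuativeRel.valuation (w.1.adicCompletion E) (2 : w.1.adicCompletion E) = 1)
    (hT : ∀ (w : PlacesOver E v) (i j : Fin 2),
      ValuativeRel.valuation (w.1.adicCompletion E) (algebraMap E (w.1.adicCompletion E) (algebraMap F E (T₀ i j))) ≤ 1)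
    (hTinv : ∀ (w : PlacesOver E v) (i j : Fin 2),
      ValuativeRel.valuation (w.1.adicCompletion E) (algebraMap E (w.1.adicCompletion E) (algebraMap F E (T₀⁻¹ i j))) ≤ 1)
    (hTb : ∀ i j (w : PlacesOver E v), Valued.v (gramS F E v 2 T₀ i j w) ≤ Valued.v (toPlace v w π) ^ (0 : ℤ))
    (hTib : ∀ i j (w : PlacesOver E v), Valued.v ((gramS F E v 2 T₀)⁻¹ i j w) ≤ Valued.v (toPlace v w π) ^ (0 : ℤ))
    {χv : ∀ w : PlacesOver E v, (w.1.adicCompletion E)ˣ →* ℂˣ}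
    (hχur : ∀ (w : PlacesOver E v) (x : (w.1.adicCompletion E)ˣ), Valued.v (x : w.1.adicCompletion E) = 1 → χv w x = 1)
    (hϖ0 : ∀ w : PlacesOver E v, toPlace v w π ≠ 0)
    {s : ℂ} {φs : UnitaryGroup.localPi E c (2 + 2) JD v → ℂ} (hφ : IsSphericalSection F E c hcδ hδ hd v 2 hT₀ hJD χv s φs)
    {ψ : AddChar (v.adicCompletion F) Circle} (hψ : Continuous ψ) (hdψ : ψ.HasConductorExp 0)
    {τ : LocalRing E v → v.adicCompletion F} (hτ : ∀ r, toLocalRing E v (τ r) = r + conjLocal E c v r) (hτadd : ∀ r s, τ (r + s) = τ r + τ s)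
    (hτs : ∀ (z : v.adicCompletion F) (r : LocalRing E v), τ (toLocalRing E v z * r) = z * τ r) (hτc : Continuous τ)
    (h2F : Valued.v (2 : v.adicCompletion F) = 1)
    (hδu : ∀ w : PlacesOver E v, Valued.v (algebraMap E (LocalRing E v) δ w) = 1)
    {ε : LocalRing E v} (hεσ : conjLocal E c v ε = -ε) (hεint : ∀ w : PlacesOver E v, Valued.v (ε w) ≤ 1)
    (hε : ∀ w : PlacesOver E v, Valued.v (toPlace v w π) ^ (0 : ℤ) ≤ Valued.v ((2 * ε) w))
    (h2 : ∀ w : PlacesOver E v, Valued.v (toPlace v w π) ^ (0 : ℤ) ≤ Valued.v ((2 : LocalRing E v) w))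
    {β βinv : Matrix (Fin 2) (Fin 2) (LocalRing E v)} (hβs : (β.map (conjLocal E c v))ᵀ * gramS F E v 2 T₀ + gramS F E v 2 T₀ * β = 0)
    (hββ : β * βinv = 1) (hβ0 : ∀ i j (w : PlacesOver E v), Valued.v (β i j w) ≤ Valued.v (toPlace v w π) ^ (0 : ℤ))
    (hβinv0 : ∀ i j (w : PlacesOver E v), Valued.v (βinv i j w) ≤ Valued.v (toPlace v w π) ^ (0 : ℤ))
 :
    ∫ t in {t : S | ∀ i j (w : PlacesOver E v), Valued.v (t.1 i j w) ≤ Valued.v (toPlace v w π) ^ (-3 : ℤ)},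
        φs (weylDelta F E c v 2 hJD * nElem F E c v 2 hJD t.1 ((hS t.1).1 t.2)) * ((ψ (-τ (Matrix.trace (β * t.1))) : Circle) : ℂ) ∂μ =
      (μ.real {t : S | ∀ i j (w : PlacesOver E v), Valued.v (t.1 i j w) ≤ Valued.v (toPlace v w π) ^ (0 : ℤ)} : ℂ) *
        ((1 - ((((∏ w : PlacesOver E v, χv w (Units.mk0 (toPlace v w π) (hϖ0 w))) : ℂˣ) : ℂ) *
          (((∏ w : PlacesOver E v, ‖toPlace v w π‖) : ℝ) : ℂ) ^ (s + 1))) *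
          (1 + (v.residueCard : ℂ) * ((((∏ w : PlacesOver E v, χv w (Units.mk0 (toPlace v w π) (hϖ0 w))) : ℂˣ) : ℂ) *
          (((∏ w : PlacesOver E v, ‖toPlace v w π‖) : ℝ) : ℂ) ^ (s + 1)))) := by
  have hI11 := setIntegral_ball_inter_det_eq_inert F E c hcδ hδ hd v hπ w₀ hw₀ hπw hT₀ hT₀d S hS μ hdψ hτ hτadd hτs h2F hδu hβs hββ hβ0 hβinv0 hTb hTib
  exact setIntegral_whittaker_unimodular_eq F E c hcδ hδ hd v hT₀ hT₀d hJD hπ hπw S hS μ h2v hT hTinv hTb hTib hχur hϖ0 hφ hψ hdψ hτ hτadd hτs hτc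
    h2F hεσ hεint hε h2 hβs hββ hβ0 hβinv0 (v.residueCard : ℂ) hI11

end Summit.HodgeConjecture.HodgeConjecture.Cruxes.HLiu418.K2LiuGoodPlaceWhittakerUnimodularValueInert

end
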